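import Literature.NumberTheory.EllipticCurves.Rank1Residual.Predicates
import Literature.NumberTheory.EllipticCurves.DivisionFieldRamificationDividesProofs
import HarnessLib

/-!
# Route `CumulativeHeegnerLeopoldt`, crux K2 `EisensteinCharacterInvariantsAtThree` (stmt-BirchSwinnertonDyer-24199):
# the NON-ANOMALOUS clause holds for EVERY rational line once it holds for one (helper, `--supports 24199`)

Lead prover `bsd-line-chl-p1` g9. The Leopoldt cell is typed as «`∃ Φ`, a rational `3`-line, with: for every prime `𝔓`
above `3` the decomposition group `D_𝔓 ≤ Γ_ℚ` (i) does not fix `Φ` pointwise and (ii) does not act trivially on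
`E[3]/Φ`», whereas the stubs of the character cut ([ALG], [BRram], its residual half `stub_ramifiedResidualFinite`,
[LOC₃]) quantify over EVERY rational line `Φ` of `E[3]`. When `E[3]` contains two distinct rational lines `Φ ≠ Φ₀`
(split semisimplification), `E[3] = Φ ⊕ Φ₀`, so `Φ ≅ E[3]/Φ₀` and `E[3]/Φ ≅ Φ₀` as Galois modules and the two
clauses are EXCHANGED: the clause is a property of the semisimplification `{φ, ψ}`, not of the line. This file
proves the transfer `nonanomalous Φ₀ → nonanomalous Φ` for any group `D` acting (pure finite group theory on a
group of order `p²` with two stable subgroups of order `p`; no arithmetic). THEOREMS ONLY; no `sorry`; imports no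
`Theses` module. BSD is not proved for any curve by any of this.
References: [GreenbergVatsal2000] §2 p. 28 (the line `Φ` and its quotient); [CastellaGrossiLeeSkinner2022] §1.1
(`E[p]^{ss} = 𝔽(φ) ⊕ 𝔽(ψ)`).
-/

set_option autoImplicit false
-- `…BirchSwinnertonDyer.BirchSwinnertonDyer.Theorems…` is the problem's mandated namespace (D-0017).
set_option linter.dupNamespace false

noncomputable section

open scoped Classical

namespace Summit.BirchSwinnertonDyer.BirchSwinnertonDyer.Theorems.EisensteinCharacterInvariantsAtThreeAnyLine

open WeierstrassCurve Field Literature.NumberTheory.EllipticCurves Literature.NumberTheory.EllipticCurves.Rank1Residual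

/-! ## §1 Two distinct subgroups of prime order in a group of order `p²` -/

section Group

variable {A : Type*} [AddCommGroup A] {p : ℕ} [hp : Fact p.Prime]

/-- Two DISTINCT subgroups of prime order `p` meet trivially. [folklore] -/
theorem inf_eq_bot_of_ne {Φ Φ₀ : AddSubgroup A} (hΦ : Nat.card Φ = p) (hΦ₀ : Nat.card Φ₀ = p) (hne : Φ ≠ Φ₀) :
    Φ ⊓ Φ₀ = ⊥ := by
  haveI : Fact (Nat.card Φ).Prime := ⟨by rw [hΦ]; exact hp.out⟩
  haveI : Finite Φ₀ := Nat.finite_of_card_ne_zero (by rw [hΦ₀]; exact hp.out.ne_zero)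
  rcases ((Φ ⊓ Φ₀).addSubgroupOf Φ).eq_bot_or_eq_top_of_prime_card with h | h
  · rw [AddSubgroup.addSubgroupOf_eq_bot] at h
    exact h.eq_bot_of_le inf_le_left
  · rw [AddSubgroup.addSubgroupOf_eq_top] at h
    have hle : Φ ≤ Φ₀ := fun x hx ↦ (h hx).2
    exact absurd (AddSubgroup.eq_of_le_of_card_ge hle (by rw [hΦ, hΦ₀])) hne

/-- In a group of order `p²`, two distinct subgroups of order `p` SPAN: every element is `a + b` with `a ∈ Φ`,
`b ∈ Φ₀`. [folklore] -/
theorem exists_add_eq_of_ne (hA : Nat.card A = p ^ 2) {Φ Φ₀ : AddSubgroup A} (hΦ : Nat.card Φ = p)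
    (hΦ₀ : Nat.card Φ₀ = p) (hne : Φ ≠ Φ₀) (x : A) : ∃ a ∈ Φ, ∃ b ∈ Φ₀, a + b = x := by
  haveI : Finite A := Nat.finite_of_card_ne_zero (by rw [hA]; exact pow_ne_zero _ hp.out.ne_zero)
  have hinf := inf_eq_bot_of_ne hΦ hΦ₀ hne
  -- the addition map `Φ × Φ₀ → A` is an injective homomorphism
  let f : Φ × Φ₀ →+ A := (AddSubgroup.subtype Φ).coprod (AddSubgroup.subtype Φ₀)
  have hf : Function.Injective f := by
    rw [injective_iff_map_eq_zero]
    rintro ⟨a, b⟩ hab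
    change (a : A) + (b : A) = 0 at hab
    have ha : (a : A) ∈ Φ ⊓ Φ₀ := by
      refine ⟨a.2, ?_⟩
      have : (a : A) = -(b : A) := eq_neg_of_add_eq_zero_left hab
      rw [this]
      exact Φ₀.neg_mem b.2
    rw [hinf, AddSubgroup.mem_bot] at ha
    have hb : (b : A) = 0 := by rw [ha, zero_add] at hab; exact hab
    exact Prod.ext (Subtype.ext ha) (Subtype.ext hb)
  -- its range has `p²` elements, hence is everything
  have hcard : Nat.card f.range = Nat.card A := by
    rw [← Nat.card_congr (AddMonoidHom.ofInjective hf).toEquiv, Nat.card_prod, hΦ, hΦ₀, hA, sq]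
  have htop : f.range = ⊤ := AddSubgroup.eq_top_of_card_eq _ hcard
  have hx : x ∈ f.range := by rw [htop]; exact AddSubgroup.mem_top x
  obtain ⟨⟨a, b⟩, hab⟩ := hx
  exact ⟨a, a.2, b, b.2, hab⟩

variable {G : Type*} [Group G] [DistribMulAction G A]

/-- **Transfer of the non-anomalous clause between two rational lines.** Let `A` have order `p²`, `Φ₀, Φ ≤ A`
subgroups of order `p` with `Φ₀` `G`-stable, `D ≤ G`. If `D` neither fixes `Φ₀` pointwise nor acts trivially on `A/Φ₀`, then
`D` neither fixes `Φ` pointwise nor acts trivially on `A/Φ`. (For `Φ = Φ₀` trivial; otherwise `A = Φ ⊕ Φ₀` and the two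
clauses are exchanged.) [cite: CastellaGrossiLeeSkinner2022, §1.1 (E[p]^{ss} = 𝔽(φ) ⊕ 𝔽(ψ))] -/
theorem nonanomalous_of_nonanomalous (hA : Nat.card A = p ^ 2) {Φ Φ₀ : AddSubgroup A}
    (hΦ : Nat.card Φ = p) (hΦ₀ : Nat.card Φ₀ = p) (hΦ₀st : ∀ g : G, ∀ P ∈ Φ₀, g • P ∈ Φ₀) (D : Subgroup G)
    (h₀ : ¬ (∀ g ∈ D, ∀ P ∈ Φ₀, g • P = P) ∧ ¬ (∀ g ∈ D, ∀ P : A, g • P - P ∈ Φ₀)) :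
    ¬ (∀ g ∈ D, ∀ P ∈ Φ, g • P = P) ∧ ¬ (∀ g ∈ D, ∀ P : A, g • P - P ∈ Φ) := by
  by_cases hne : Φ = Φ₀
  · subst hne; exact h₀
  have hinf := inf_eq_bot_of_ne hΦ hΦ₀ hne
  refine ⟨fun hfix ↦ h₀.2 fun g hg P ↦ ?_, fun htriv ↦ h₀.1 fun g hg P hP ↦ ?_⟩
  · -- `D` fixes `Φ` pointwise ⟹ `D` acts trivially on `A/Φ₀` (decompose `P = a + b`)
    obtain ⟨a, ha, b, hb, rfl⟩ := exists_add_eq_of_ne hA hΦ hΦ₀ hne P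
    have : g • (a + b) - (a + b) = g • b - b := by rw [smul_add, hfix g hg a ha]; abel
    rw [this]
    exact Φ₀.sub_mem (hΦ₀st g b hb) hb
  · -- `D` trivial on `A/Φ` ⟹ `D` fixes `Φ₀` pointwise (`gP − P ∈ Φ ⊓ Φ₀ = ⊥`)
    have h1 : g • P - P ∈ Φ ⊓ Φ₀ := ⟨htriv g hg P, Φ₀.sub_mem (hΦ₀st g P hP) hP⟩
    rw [hinf, AddSubgroup.mem_bot] at h1
    exact sub_eq_zero.mp h1

end Group

/-! ## §2 The Leopoldt-cell clause for every rational `3`-line -/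

/-- **On `E[p]` of an elliptic curve over a number field base-changed … — here over `ℚ`: if ONE rational `p`-line is
non-anomalous at (every prime of `\bar ℤ` above) `p`, then EVERY rational `p`-line is.** For `W/ℚ` elliptic, `p`
prime, rational lines `Φ₀`, `Φ` (`IsRationalLine`: order `p`, `Γ_ℚ`-stable) and the cell clause for `Φ₀`, the
cell clause holds for `Φ` (`#E[p] = p²`, `natCard_geomTorsion_prime_eq_sq`, and §1).
[cite: CastellaGrossiLeeSkinner2022, §1.1] [cite: GreenbergVatsal2000, §2 p. 28] -/
theorem cellClause_of_cellClause (W : WeierstrassCurve ℚ) [W.IsElliptic] (p : ℕ) [Fact p.Prime]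
    {Φ₀ Φ : AddSubgroup (W.geomTorsion (p : ℤ))} (hΦ₀ : IsRationalLine W p Φ₀) (hΦ : IsRationalLine W p Φ)
    (h₀ : ∀ (v : IsDedekindDomain.HeightOneSpectrum (NumberField.RingOfIntegers ℚ)),
      ((p : ℕ) : NumberField.RingOfIntegers ℚ) ∈ v.asIdeal → ∀ 𝔓 ∈ v.primesAbove,
        ¬ (∀ g ∈ 𝔓.decompositionSubgroup (absoluteGaloisGroup ℚ), ∀ P ∈ Φ₀, g • P = P) ∧
        ¬ (∀ g ∈ 𝔓.decompositionSubgroup (absoluteGaloisGroup ℚ),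
            ∀ P : W.geomTorsion (p : ℤ), g • P - P ∈ Φ₀)) :
    ∀ (v : IsDedekindDomain.HeightOneSpectrum (NumberField.RingOfIntegers ℚ)),
      ((p : ℕ) : NumberField.RingOfIntegers ℚ) ∈ v.asIdeal → ∀ 𝔓 ∈ v.primesAbove,
        ¬ (∀ g ∈ 𝔓.decompositionSubgroup (absoluteGaloisGroup ℚ), ∀ P ∈ Φ, g • P = P) ∧
        ¬ (∀ g ∈ 𝔓.decompositionSubgroup (absoluteGaloisGroup ℚ),
            ∀ P : W.geomTorsion (p : ℤ), g • P - P ∈ Φ) :=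
  fun v hv 𝔓 h𝔓 ↦
    nonanomalous_of_nonanomalous (W.natCard_geomTorsion_prime_eq_sq (Fact.out : p.Prime)) hΦ.1 hΦ₀.1 hΦ₀.2
      (𝔓.decompositionSubgroup (absoluteGaloisGroup ℚ)) (h₀ v hv 𝔓 h𝔓)

end Summit.BirchSwinnertonDyer.BirchSwinnertonDyer.Theorems.EisensteinCharacterInvariantsAtThreeAnyLine

end
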